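import Mathlib
import Literature.Probability.LatticeModels.ProdBernoulliIndependence
import Literature.Probability.Percolation.PercolationProofs
import Literature.Probability.Percolation.PercolationEvents
import Literature.Probability.Percolation.Crossings
import Literature.Probability.Percolation.HalfSpacePinnedPairs
import HarnessLib

/-!
# Crux `PercNearOneGluing.NoHeavyLowerTail` (stmt-CriticalPhenomena-4575), line `bhk-superadditivity-thinning` —
# off-set reliability transfer (Harris)

Lead prover-line-stmt-CriticalPhenomena-4575-c1-0, 2026-08-16. A tool lemma for the residual
`stub_manyFingersLargePocket` (≡ Kozma–Nitzan Conjecture 3): every analysis of the residual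
(the `(W,ρ)`-form, the contracted graph `G_W`, the selection-cost reduction `pocketSelectionBound`,
the exploration calculus of the lead's notes) needs to control the *deadness of a relay after a
vertex set is deleted*, `P_{G−S}(a ↮ b)`, by the relay's reliability in `G`.  Harris' inequality for
two decreasing events gives the clean, `|A|`-free transfer

  `P(a ↮ b avoiding S) · P(S ↮ b) ≤ P(a ↮ b)`,

because an open `a—b` path either avoids `S` (excluded by the first event) or passes through some
`s ∈ S`, whose tail joins `s` to `b` (excluded by the second).  With `S = {o}`:
`P_{G−o}(a ↮ b) ≤ P(a ↮ b) / P(o ↮ b)` — deleting the observer degrades relay reliability by at most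
the factor `1/u`, `u = P(o ↮ b)`, which is harmless in an `ε–δ` argument (`u ≥ ε` on a counterexample).

Main results:
* `notConnIn_compl_inter_subset` — the pointwise inclusion
  `{a ↮ b in Sᶜ} ∩ ⋂_{s∈S} {s ↮ b} ⊆ {a ↮ b}`.
* `offSet_reliability_transfer'` / `offSet_reliability_transfer` (registered form) —
  `μ{a ↮ b in Sᶜ} · μ(⋂_{s∈S} {s ↮ b}) ≤ μ{a ↮ b}` under any `prodBernoulli w` on `Fin n`.
* `offVertex_reliability_transfer` — the case `S = {o}`.
-/

namespace Summit.CriticalPhenomena.PercolationContinuityZ3.Theorems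

open MeasureTheory Set
open Literature.Probability.LatticeModels (prodBernoulli)
open Literature.Probability.Percolation

variable {V : Type*}

/-- **Pointwise splitting of an open path at a vertex set.**  If `a` is not joined to `b` by an open
path inside `Sᶜ`, and no vertex of `S` is joined to `b` at all, then `a` is not joined to `b`:
an open walk from `a` to `b` either has all its vertices outside `S`, or contains some `s ∈ S`, and
then its tail is an open walk from `s` to `b`. [folklore] -/
theorem notConnIn_compl_inter_subset (S : Set V) (a b : V) :
    ((openConnIn Sᶜ a b)ᶜ ∩ {ω : BondConfig V | ∀ s ∈ S, ω ∉ openConn s b})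
      ⊆ (openConn a b)ᶜ := by
  classical
  rintro ω ⟨hIn, hS⟩ hab
  obtain ⟨q⟩ := (hab : (openGraph ω).Reachable a b)
  by_cases h : ∀ y ∈ q.support, y ∈ Sᶜ
  · exact hIn ⟨h a q.start_mem_support, h b q.end_mem_support, ⟨q.induce Sᶜ h⟩⟩
  · push Not at h
    obtain ⟨s, hsq, hsS⟩ := h
    have hsS' : s ∈ S := Set.not_notMem.1 hsS
    exact hS s hsS' ⟨q.dropUntil s hsq⟩

variable {n : ℕ}

/-- **Off-set reliability transfer (Harris).**  For every weight function `w` on the pairs of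
`Fin n`, every vertex set `S` and vertices `a, b`:
`μ{a ↮ b in Sᶜ} · μ{∀ s ∈ S, s ↮ b} ≤ μ{a ↮ b}`, `μ = prodBernoulli w`.  Both events on the left are
decreasing, so Harris' inequality bounds the product by the measure of the intersection, which lies
in `{a ↮ b}` by `notConnIn_compl_inter_subset`.  Typical use: `S` = an explored or deleted pocket,
so that `μ{a ↮ b in Sᶜ} = P_{G−S}(a ↮ b) ≤ P(a ↮ b)/P(S ↮ b)`. [folklore] -/
theorem offSet_reliability_transfer' (w : Sym2 (Fin n) → unitInterval) (S : Set (Fin n))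
    (a b : Fin n) :
    (prodBernoulli w).real (openConnIn Sᶜ a b)ᶜ *
        (prodBernoulli w).real {ω : BondConfig (Fin n) | ∀ s ∈ S, ω ∉ openConn s b}
      ≤ (prodBernoulli w).real (openConn a b)ᶜ := by
  have hA : IsLowerSet ((openConnIn Sᶜ a b)ᶜ : Set (BondConfig (Fin n))) :=
    (isUpperSet_openConnIn Sᶜ a b).compl
  have hB : IsLowerSet {ω : BondConfig (Fin n) | ∀ s ∈ S, ω ∉ openConn s b} := by
    intro ω ω' hle hω s hs hs'
    exact hω s hs (isUpperSet_openConn s b hle hs')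
  have hAm : MeasurableSet ((openConnIn Sᶜ a b)ᶜ : Set (BondConfig (Fin n))) :=
    (measurableSet_openConnIn_of_countable Sᶜ a b).compl
  have hBeq : {ω : BondConfig (Fin n) | ∀ s ∈ S, ω ∉ openConn s b} = ⋂ s ∈ S, (openConn s b)ᶜ := by
    ext ω; simp only [Set.mem_setOf_eq, Set.mem_iInter, Set.mem_compl_iff]
  have hBm : MeasurableSet {ω : BondConfig (Fin n) | ∀ s ∈ S, ω ∉ openConn s b} := by
    rw [hBeq]
    exact MeasurableSet.biInter (Set.to_countable S) fun s _ => (measurableSet_openConn_holds (V := Fin n) s b).compl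
  calc (prodBernoulli w).real (openConnIn Sᶜ a b)ᶜ *
        (prodBernoulli w).real {ω : BondConfig (Fin n) | ∀ s ∈ S, ω ∉ openConn s b}
      ≤ (prodBernoulli w).real ((openConnIn Sᶜ a b)ᶜ ∩
          {ω : BondConfig (Fin n) | ∀ s ∈ S, ω ∉ openConn s b}) :=
        Literature.Probability.LatticeModels.prodBernoulli_harris_lower w hA hB hAm hBm
    _ ≤ (prodBernoulli w).real (openConn a b)ᶜ :=
        measureReal_mono (notConnIn_compl_inter_subset S a b)

/-- **Off-vertex reliability transfer.**  `μ{a ↮ b avoiding o} · μ{o ↮ b} ≤ μ{a ↮ b}`: deleting the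
observer `o` degrades the reliability of a relay `a` by at most the factor `1 / P(o ↮ b)`.
The case `S = {o}` of `offSet_reliability_transfer`. [folklore] -/
theorem offVertex_reliability_transfer (w : Sym2 (Fin n) → unitInterval) (o a b : Fin n) :
    (prodBernoulli w).real (openConnIn ({o} : Set (Fin n))ᶜ a b)ᶜ *
        (prodBernoulli w).real (openConn o b)ᶜ
      ≤ (prodBernoulli w).real (openConn a b)ᶜ := by
  have h := offSet_reliability_transfer' w ({o} : Set (Fin n)) a b
  have heq : {ω : BondConfig (Fin n) | ∀ s ∈ ({o} : Set (Fin n)), ω ∉ openConn s b}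
      = (openConn o b)ᶜ := by
    ext ω; simp
  rw [heq] at h
  exact h

/-- **Off-set reliability transfer** — the registered form (explicit `n`, fully qualified names) of
`offSet_reliability_transfer'`: `μ{a ↮ b in Sᶜ} · μ{∀ s ∈ S, s ↮ b} ≤ μ{a ↮ b}` under
`μ = prodBernoulli w`. [folklore] -/
theorem offSet_reliability_transfer : ∀ (n : ℕ) (w : Sym2 (Fin n) → unitInterval) (S : Set (Fin n)) (a b : Fin n), (Literature.Probability.LatticeModels.prodBernoulli w).real (Literature.Probability.Percolation.openConnIn Sᶜ a b)ᶜ * (Literature.Probability.LatticeModels.prodBernoulli w).real {ω : Literature.Probability.Percolation.BondConfig (Fin n) | ∀ s ∈ S, ω ∉ Literature.Probability.Percolation.openConn s b} ≤ (Literature.Probability.LatticeModels.prodBernoulli w).real (Literature.Probability.Percolation.openConn a b)ᶜ :=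
  fun _ w S a b => offSet_reliability_transfer' w S a b

end Summit.CriticalPhenomena.PercolationContinuityZ3.Theorems
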